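import Literature.Combinatorics.Designs.LegendrePairs

/-!
# The `n/3 + 1` multiplier obstruction for Legendre pairs of length `n ≡ 0 (mod 9)`

Let `n = 3m` with `3 ∣ m`.  No Legendre pair `(a, b)` of length `n` has a sequence invariant under the
multiplier `m + 1` (or `2m + 1 = (m+1)⁻¹`, whose square is `m + 1`): `no_legendrePair_mul`.  Only ONE sequence and
ONE shift (`s = m`) of the Legendre condition are used: writing `3 · PAF_c(m) = Σ_i q_i` with fibre terms
`q_i = c_i c_{i+m} + c_{i+m} c_{i+2m} + c_{i+2m} c_i ≥ -1`, invariance under `m + 1` (which maps `i ↦ i + m·(i mod 3)`)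
makes `c` constant on the fibre of every `i` prime to `3`, so `q_i = 3` there and `3 · PAF_a(m) ≥ 5m`, while
`3 · PAF_b(m) ≥ -3m = -n`; together `3 (PAF_a(m) + PAF_b(m)) ≥ 2m > -6`.

Instances (§3): length `333` (`m = 111`, multiplier `112`; `31⁴ = 112`): rows 2 `⟨112⟩` and 7 `⟨73,112⟩` of
[Ramos–Hulak–de Queiroz, arXiv:2607.20765v1, Table A1] — listed OPEN there — and rows 11 `⟨10,112⟩`, 15 `⟨31⟩`,
24 `⟨10,31⟩` — excluded there by full-image compression and certified pseudo-Boolean computation — admit no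
`H`-invariant Legendre pair; length `117` (`m = 39`, multiplier `40`): no Legendre pair of length 117 has a
sequence whose multiplier group contains `40`, even in the translation-twisted sense of Kotsireas–Koutschan
(via the centroid shift of `LegendrePairs.lean`), which settles the subgroup `H₂ = {1, 40, 79}` that
[Kotsireas–Koutschan, J. Combin. Des. 29 (2021), arXiv:2101.03116, §4.1.2] left undecided ("we have not been able to
construct Legendre pairs of length 117 using H₂").

Provenance.  The special cases `n = 333`, `|H| ≥ 9` are published exclusions (arXiv:2607.20765 Thm 1); the uniform
computation-free statement, rows 2 and 7, and the `H₂` corollary were proved inside the pub-lottery cell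
(2026-08-19; two independent sieve implementations agree with it on every instance, and the Lean proof below is the
certificate).  They are NOT claimed to appear in the literature (searched: arXiv:2607.20765 and its references,
the works citing arXiv:2101.03116 in the local citation graph, corpus + galaxy full text for
"multiplier" ∧ "Legendre pair"; FRESHNESS record of the cell).  No `sorry`, no new axioms, no `native_decide`.
-/

open Finset BigOperators

namespace Literature.Combinatorics.Designs.LegendrePairs

variable {n : ℕ} [NeZero n]

/-! ## §1 Fibre terms of `3 · PAF` -/

/-- The fibre term `q_i = c_i c_{i+s} + c_{i+s} c_{i+2s} + c_{i+2s} c_i` of `3 · PAF_c(s)` when `3s = 0`. [folklore] -/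
def q (c : ZMod n → ℤ) (s : ZMod n) (i : ZMod n) : ℤ :=
  c i * c (i + s) + c (i + s) * c (i + s + s) + c (i + s + s) * c i

/-- For `u, v, w = ±1`: `uv + vw + wu ≥ -1`. [folklore] -/
lemma tri (u v w : ℤ) (hu : u = 1 ∨ u = -1) (hv : v = 1 ∨ v = -1) (hw : w = 1 ∨ w = -1) :
    -1 ≤ u * v + v * w + w * u := by
  rcases hu with rfl | rfl <;> rcases hv with rfl | rfl <;> rcases hw with rfl | rfl <;> norm_num

omit [NeZero n] in
/-- Each fibre term of a `±1` sequence is `≥ -1`. [folklore] -/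
lemma q_ge (c : ZMod n → ℤ) (hc : ∀ i, c i = 1 ∨ c i = -1) (s i : ZMod n) : -1 ≤ q c s i := by
  unfold q; exact tri _ _ _ (hc _) (hc _) (hc _)

/-- `3 · PAF_c(s) = Σ_i q_i` whenever `3 s = 0` in `ZMod n` (re-indexing two of the three copies). [folklore] -/
lemma three_paf (c : ZMod n → ℤ) (s : ZMod n) (hs : s + s + s = 0) :
    3 * PAF c s = ∑ i, q c s i := by
  unfold PAF q
  have e1 : ∑ i : ZMod n, c (i + s) * c (i + s + s) = ∑ i : ZMod n, c i * c (i + s) := by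
    have := Equiv.sum_comp (Equiv.addRight s) (fun i => c i * c (i + s))
    simpa only [Equiv.coe_addRight] using this
  have e2 : ∑ i : ZMod n, c (i + s + s) * c i = ∑ i : ZMod n, c i * c (i + s) := by
    have := Equiv.sum_comp (Equiv.addRight (s + s)) (fun i => c i * c (i + s))
    simp only [Equiv.coe_addRight] at this
    rw [← this]
    refine Finset.sum_congr rfl fun i _ => ?_
    have h3 : i + (s + s) + s = i := by
      have : i + (s + s) + s = i + (s + s + s) := by ring
      rw [this, hs, add_zero]
    rw [h3]; ring_nf
  rw [Finset.sum_add_distrib, Finset.sum_add_distrib, e1, e2]; ring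

/-- Hence `3 · PAF_c(s) ≥ -n` for a `±1` sequence and `3 s = 0`. [folklore] -/
lemma three_paf_ge (c : ZMod n → ℤ) (hc : ∀ i, c i = 1 ∨ c i = -1) (s : ZMod n) (hs : s + s + s = 0) :
    -(n : ℤ) ≤ 3 * PAF c s := by
  rw [three_paf c s hs]
  have : ∑ _i : ZMod n, (-1 : ℤ) ≤ ∑ i : ZMod n, q c s i := Finset.sum_le_sum fun i _ => q_ge c hc s i
  simpa [ZMod.card] using this


/-! ### arithmetic in `ZMod n`, `n = 3m`, `3 ∣ m` -/

/-- `(i + t).val ≡ i.val + t (mod 3)` in `ZMod n` when `3 ∣ n`. [folklore] -/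
lemma val_add_natCast_mod3 (h3n : 3 ∣ n) (i : ZMod n) (t : ℕ) :
    (i + (t : ZMod n)).val % 3 = (i.val + t) % 3 := by
  rw [ZMod.val_add, ZMod.val_natCast, Nat.mod_mod_of_dvd _ h3n, Nat.add_mod, Nat.mod_mod_of_dvd _ h3n,
    ← Nat.add_mod]

/-- `(m+1) · i = i + m · (i.val % 3)` in `ZMod (3m)`: the multiplier `m+1` shifts `i` by `m` times its residue mod 3. [folklore] -/
lemma mul_shift {m : ℕ} (hn : n = 3 * m) (i : ZMod n) :
    ((m : ZMod n) + 1) * i = i + (m : ZMod n) * ((i.val % 3 : ℕ) : ZMod n) := by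
  subst hn
  have hnat : m * i.val = m * (i.val % 3) + 3 * m * (i.val / 3) := by
    calc m * i.val = m * (i.val % 3 + 3 * (i.val / 3)) := by rw [Nat.mod_add_div]
      _ = m * (i.val % 3) + 3 * m * (i.val / 3) := by ring
  have hz : ((m * i.val : ℕ) : ZMod (3 * m)) = ((m * (i.val % 3) + 3 * m * (i.val / 3) : ℕ) : ZMod (3 * m)) := by
    rw [hnat]
  have hself : ((3 * m : ℕ) : ZMod (3 * m)) = 0 := ZMod.natCast_self _
  have key : (m : ZMod (3 * m)) * i = (m : ZMod (3 * m)) * ((i.val % 3 : ℕ) : ZMod (3 * m)) := by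
    have e : (m : ZMod (3 * m)) * i = ((m * i.val : ℕ) : ZMod (3 * m)) := by
      rw [Nat.cast_mul, ZMod.natCast_zmod_val]
    rw [e, hz, Nat.cast_add, Nat.cast_mul, Nat.cast_mul, hself, zero_mul, add_zero]
  rw [add_mul, one_mul, key, add_comm]

/-- adding `m` does not change the residue mod 3 when `3 ∣ m`. [folklore] -/
lemma val_add_m_mod3 {m : ℕ} (hn : n = 3 * m) (h3 : 3 ∣ m) (i : ZMod n) :
    (i + (m : ZMod n)).val % 3 = i.val % 3 := by
  have h3n : 3 ∣ n := hn ▸ dvd_mul_right 3 m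
  rw [val_add_natCast_mod3 h3n, Nat.add_mod, Nat.mod_eq_zero_of_dvd h3, add_zero, Nat.mod_mod_of_dvd _ (dvd_refl 3)]

/-- invariance under `i ↦ (m+1) i` makes the fibre `{i, i+m, i+2m}` constant when `3 ∤ i`. [cite: RamosHulakDeQueiroz2026, Thm 1 (Table A1 rows 11, 15, 24); uniform statement proved here] -/
lemma fibre_const {m : ℕ} (hn : n = 3 * m) (h3 : 3 ∣ m) (a : ZMod n → ℤ)
    (hinv : ∀ i, a (((m : ZMod n) + 1) * i) = a i) (i : ZMod n) (hi : i.val % 3 ≠ 0) :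
    a (i + (m : ZMod n)) = a i ∧ a (i + (m : ZMod n) + (m : ZMod n)) = a i := by
  have hlt : i.val % 3 < 3 := Nat.mod_lt _ (by norm_num)
  have hself : ((n : ℕ) : ZMod n) = 0 := ZMod.natCast_self _
  have h3m : (m : ZMod n) + (m : ZMod n) + (m : ZMod n) = 0 := by
    have : ((3 * m : ℕ) : ZMod n) = 0 := by rw [← hn]; exact hself
    have e : (m : ZMod n) + (m : ZMod n) + (m : ZMod n) = ((3 * m : ℕ) : ZMod n) := by push_cast; ring
    rw [e, this]
  set s : ZMod n := (m : ZMod n) with hs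
  have r1 : (i + s).val % 3 = i.val % 3 := val_add_m_mod3 hn h3 i
  have r2 : (i + s + s).val % 3 = i.val % 3 := by rw [val_add_m_mod3 hn h3 (i + s), r1]
  rcases Nat.lt_or_ge (i.val % 3) 2 with h | h
  · -- residue 1 : (m+1) i = i + s, (m+1)(i+s) = i + 2s
    have hr : i.val % 3 = 1 := by omega
    have e1 : (s + 1) * i = i + s := by rw [mul_shift hn i, hr]; simp [hs]
    have e2 : (s + 1) * (i + s) = i + s + s := by
      rw [mul_shift hn (i + s), r1, hr]; simp [hs]
    have h1 := hinv i; have h2 := hinv (i + s)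
    rw [e1] at h1; rw [e2] at h2
    exact ⟨h1, by rw [h2, h1]⟩
  · -- residue 2 : (m+1) i = i + 2s, (m+1)(i+2s) = i + 4s = i + s
    have hr : i.val % 3 = 2 := by omega
    have e1 : (s + 1) * i = i + s + s := by
      rw [mul_shift hn i, hr]; simp [hs]; ring
    have e2 : (s + 1) * (i + s + s) = i + s := by
      rw [mul_shift hn (i + s + s), r2, hr]
      have : i + s + s + s * ((2 : ℕ) : ZMod n) = i + s + (s + s + s) := by push_cast; ring
      rw [this, h3m, add_zero]
    have h1 := hinv i; have h2 := hinv (i + s + s)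
    rw [e1] at h1; rw [e2] at h2
    exact ⟨by rw [h2, h1], h1⟩

/-- … so the fibre term equals `3` there. [cite: RamosHulakDeQueiroz2026, Thm 1 (Table A1 rows 11, 15, 24); uniform statement proved here] -/
lemma q_eq_three {m : ℕ} (hn : n = 3 * m) (h3 : 3 ∣ m) (a : ZMod n → ℤ) (ha : ∀ i, a i = 1 ∨ a i = -1)
    (hinv : ∀ i, a (((m : ZMod n) + 1) * i) = a i) (i : ZMod n) (hi : i.val % 3 ≠ 0) :
    q a (m : ZMod n) i = 3 := by
  obtain ⟨e1, e2⟩ := fibre_const hn h3 a hinv i hi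
  unfold q; rw [e1, e2]
  rcases ha i with h | h <;> rw [h] <;> norm_num

/-- three consecutive fibre terms sum to at least `5` (two of the three indices are `≢ 0 (mod 3)`). [cite: RamosHulakDeQueiroz2026, Thm 1 (Table A1 rows 11, 15, 24); uniform statement proved here] -/
lemma q_three_consecutive {m : ℕ} (hn : n = 3 * m) (h3 : 3 ∣ m) (a : ZMod n → ℤ) (ha : ∀ i, a i = 1 ∨ a i = -1)
    (hinv : ∀ i, a (((m : ZMod n) + 1) * i) = a i) (i : ZMod n) :
    5 ≤ q a (m : ZMod n) i + q a (m : ZMod n) (i + 1) + q a (m : ZMod n) (i + 1 + 1) := by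
  have h3n : 3 ∣ n := hn ▸ dvd_mul_right 3 m
  have v1 : (i + 1).val % 3 = (i.val + 1) % 3 := by
    have := val_add_natCast_mod3 h3n i 1; simpa using this
  have v2 : (i + 1 + 1).val % 3 = (i.val + 2) % 3 := by
    have := val_add_natCast_mod3 h3n (i + 1) 1
    simp only [Nat.cast_one] at this
    rw [this, Nat.add_mod, v1]; omega
  have g0 := q_ge a ha (m : ZMod n) i
  have g1 := q_ge a ha (m : ZMod n) (i + 1)
  have g2 := q_ge a ha (m : ZMod n) (i + 1 + 1)
  have t0 := q_eq_three hn h3 a ha hinv i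
  have t1 := q_eq_three hn h3 a ha hinv (i + 1)
  have t2 := q_eq_three hn h3 a ha hinv (i + 1 + 1)
  have hlt : i.val % 3 < 3 := Nat.mod_lt _ (by norm_num)
  rcases Nat.lt_or_ge (i.val % 3) 1 with h | h
  · have : i.val % 3 = 0 := by omega
    have n1 : (i + 1).val % 3 ≠ 0 := by rw [v1]; omega
    have n2 : (i + 1 + 1).val % 3 ≠ 0 := by rw [v2]; omega
    linarith [t1 n1, t2 n2]
  rcases Nat.lt_or_ge (i.val % 3) 2 with h' | h'
  · have : i.val % 3 = 1 := by omega
    have n0 : i.val % 3 ≠ 0 := by omega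
    have n1 : (i + 1).val % 3 ≠ 0 := by rw [v1]; omega
    linarith [t0 n0, t1 n1]
  · have : i.val % 3 = 2 := by omega
    have n0 : i.val % 3 ≠ 0 := by omega
    have n2 : (i + 1 + 1).val % 3 ≠ 0 := by rw [v2]; omega
    linarith [t0 n0, t2 n2]

/-- Summing over `i`: `3 · Σ_i q_i ≥ 5 n`, i.e. `3 · PAF_a(m) ≥ 5m`. [cite: RamosHulakDeQueiroz2026, Thm 1 (Table A1 rows 11, 15, 24); uniform statement proved here] -/
lemma sum_q_ge {m : ℕ} (hn : n = 3 * m) (h3 : 3 ∣ m) (a : ZMod n → ℤ) (ha : ∀ i, a i = 1 ∨ a i = -1)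
    (hinv : ∀ i, a (((m : ZMod n) + 1) * i) = a i) :
    5 * (n : ℤ) ≤ 3 * ∑ i, q a (m : ZMod n) i := by
  have e1 : ∑ i : ZMod n, q a (m : ZMod n) (i + 1) = ∑ i : ZMod n, q a (m : ZMod n) i :=
    Equiv.sum_comp (Equiv.addRight (1 : ZMod n)) (fun i => q a (m : ZMod n) i)
  have e2 : ∑ i : ZMod n, q a (m : ZMod n) (i + 1 + 1) = ∑ i : ZMod n, q a (m : ZMod n) i := by
    have := Equiv.sum_comp (Equiv.addRight (1 + 1 : ZMod n)) (fun i => q a (m : ZMod n) i)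
    simp only [Equiv.coe_addRight] at this
    rw [← this]; refine Finset.sum_congr rfl fun i _ => ?_; rw [add_assoc]
  have hsum : ∑ _i : ZMod n, (5 : ℤ) ≤ ∑ i : ZMod n, (q a (m : ZMod n) i + q a (m : ZMod n) (i + 1) + q a (m : ZMod n) (i + 1 + 1)) :=
    Finset.sum_le_sum fun i _ => q_three_consecutive hn h3 a ha hinv i
  rw [Finset.sum_add_distrib, Finset.sum_add_distrib, e1, e2] at hsum
  simp [ZMod.card] at hsum
  linarith

/-! ## §2 The obstruction -/

/-- **The `n/3 + 1` multiplier obstruction.** `n = 3m`, `3 ∣ m`: no pair of `±1` sequences on `ZMod n` with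
`PAF_a(m) + PAF_b(m) = -2` has `a` invariant under the multiplier `m + 1`.  Proof: `3·PAF_a(m) = Σ q_i ≥ 5m`
by `fibre_const`, while `3·PAF_b(m) ≥ -3m`, contradicting `PAF_a(m) + PAF_b(m) = -2`.  The special cases
`n = 333`, `H ∋ 112` with `|H| ≥ 9` are excluded (by compression + certified PB/DRAT computation) in
[cite: RamosHulakDeQueiroz2026, Thm 1 (Table A1 rows 11, 15, 24); uniform statement proved here]; the uniform statement (every `n ≡ 0 (mod 9)`, ONE sequence, no computation) was proved in the
pub-lottery cell (2026-08-19) and is not claimed to be in the literature. -/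
theorem no_pair_mul_succ {m : ℕ} (hn : n = 3 * m) (h3 : 3 ∣ m) (a b : ZMod n → ℤ)
    (ha : ∀ i, a i = 1 ∨ a i = -1) (hb : ∀ i, b i = 1 ∨ b i = -1)
    (hL : PAF a (m : ZMod n) + PAF b (m : ZMod n) = -2)
    (hinv : ∀ i, a (((m : ZMod n) + 1) * i) = a i) : False := by
  have hself : ((n : ℕ) : ZMod n) = 0 := ZMod.natCast_self _
  have h3m : (m : ZMod n) + (m : ZMod n) + (m : ZMod n) = 0 := by
    have : ((3 * m : ℕ) : ZMod n) = 0 := by rw [← hn]; exact hself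
    have e : (m : ZMod n) + (m : ZMod n) + (m : ZMod n) = ((3 * m : ℕ) : ZMod n) := by push_cast; ring
    rw [e, this]
  have hA := sum_q_ge hn h3 a ha hinv
  rw [← three_paf a (m : ZMod n) h3m] at hA
  have hB := three_paf_ge b hb (m : ZMod n) h3m
  have hnpos : (0 : ℤ) < n := by
    have := NeZero.ne n; exact_mod_cast Nat.pos_of_ne_zero this
  nlinarith

/-- Legendre-pair corollary: no Legendre pair of length `n = 3m`, `3 ∣ m`, has either sequence invariant under the
multiplier `m + 1`. [cite: RamosHulakDeQueiroz2026, Thm 1 (Table A1 rows 11, 15, 24); uniform statement proved here] -/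
theorem no_legendrePair_mul_succ {m : ℕ} (hn : n = 3 * m) (h3 : 3 ∣ m) (a b : ZMod n → ℤ)
    (ha : ∀ i, a i = 1 ∨ a i = -1) (hb : ∀ i, b i = 1 ∨ b i = -1)
    (hLP : ∀ s : ZMod n, s ≠ 0 → PAF a s + PAF b s = -2)
    (hinv : (∀ i, a (((m : ZMod n) + 1) * i) = a i) ∨ (∀ i, b (((m : ZMod n) + 1) * i) = b i)) : False := by
  have hmpos : 0 < m := by
    rcases Nat.eq_zero_or_pos m with h0 | h0
    · exfalso; subst h0; simp at hn; exact NeZero.ne n hn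
    · exact h0
  have hm0 : (m : ZMod n) ≠ 0 := by
    intro h
    have hv : ((m : ℕ) : ZMod n).val = m % n := ZMod.val_natCast (n := n) m
    rw [h, ZMod.val_zero] at hv
    have : m % n = m := Nat.mod_eq_of_lt (by omega)
    omega
  have hL := hLP (m : ZMod n) hm0
  rcases hinv with h | h
  · exact no_pair_mul_succ hn h3 a b ha hb hL h
  · exact no_pair_mul_succ hn h3 b a hb ha (by rw [← hL]; ring) h

omit [NeZero n] in
/-- `(2m+1)² = m+1` in `ZMod (3m)` when `3 ∣ m`. [folklore] -/
lemma sq_two_m_succ {m : ℕ} (hn : n = 3 * m) (h3 : 3 ∣ m) :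
    (2 * (m : ZMod n) + 1) * (2 * (m : ZMod n) + 1) = (m : ZMod n) + 1 := by
  obtain ⟨k, hk⟩ := h3
  have h1 : (3 : ZMod n) * (m : ZMod n) = 0 := by
    have : ((3 * m : ℕ) : ZMod n) = 0 := by rw [← hn]; exact ZMod.natCast_self _
    push_cast at this; exact this
  have h2 : (m : ZMod n) = 3 * (k : ZMod n) := by rw [hk]; push_cast; ring
  linear_combination (4 * (m : ZMod n)) * h2 + (4 * (k : ZMod n) + 1) * h1

omit [NeZero n] in
/-- invariance under `2m+1` implies invariance under `(2m+1)² = m+1`. [folklore] -/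
lemma inv_of_inv_sq {m : ℕ} (hn : n = 3 * m) (h3 : 3 ∣ m) (a : ZMod n → ℤ)
    (hinv : ∀ i, a ((2 * (m : ZMod n) + 1) * i) = a i) : ∀ i, a (((m : ZMod n) + 1) * i) = a i := by
  intro i
  rw [← sq_two_m_succ hn h3, mul_assoc, hinv, hinv]

/-- Both multipliers `m+1` and `2m+1`, either sequence: no Legendre pair of length `n = 3m`, `3 ∣ m`, has a sequence
invariant under `h ∈ {m+1, 2m+1}`. [cite: RamosHulakDeQueiroz2026, Thm 1 (Table A1 rows 11, 15, 24); uniform statement proved here] -/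
theorem no_legendrePair_mul {m : ℕ} (hn : n = 3 * m) (h3 : 3 ∣ m) (a b : ZMod n → ℤ)
    (ha : ∀ i, a i = 1 ∨ a i = -1) (hb : ∀ i, b i = 1 ∨ b i = -1)
    (hLP : ∀ s : ZMod n, s ≠ 0 → PAF a s + PAF b s = -2)
    (h : ZMod n) (hh : h = (m : ZMod n) + 1 ∨ h = 2 * (m : ZMod n) + 1)
    (hinv : (∀ i, a (h * i) = a i) ∨ (∀ i, b (h * i) = b i)) : False := by
  rcases hh with rfl | rfl
  · exact no_legendrePair_mul_succ hn h3 a b ha hb hLP hinv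
  · refine no_legendrePair_mul_succ hn h3 a b ha hb hLP ?_
    rcases hinv with hi | hi
    · exact Or.inl (inv_of_inv_sq hn h3 a hi)
    · exact Or.inr (inv_of_inv_sq hn h3 b hi)


/-! ## §3 Instances: length 333 (arXiv:2607.20765 Table A1, rows containing `112 = 31⁴`) and length 117 (`H₂ ∋ 40`) -/

section Length333

/-- Rows 2 `⟨112⟩`, 7 `⟨73,112⟩` (listed open) and 11 `⟨10,112⟩`, 15 `⟨31⟩`, 24 `⟨10,31⟩` (excluded) of Table A1:
no Legendre pair of length `333` has its first sequence invariant under the multiplier `112`; the other generators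
and the second sequence are not needed. [cite: RamosHulakDeQueiroz2026, Table A1 rows 2, 7, 11, 15, 24] -/
theorem no_legendrePair333_mul112 (a b : ZMod 333 → ℤ) (h : LegendrePair a b)
    (h112 : ∀ i, a (112 * i) = a i) : False :=
  no_legendrePair_mul_succ (n := 333) (m := 111) (by norm_num) (by norm_num) a b h.1 h.2.1 h.2.2
    (Or.inl (by intro i; have := h112 i; push_cast; norm_num; exact this))

/-- Row 15 `⟨31⟩` (and 24 `⟨10,31⟩`): invariance of one sequence under `31` already suffices, since `31⁴ = 112`
in `ZMod 333`. [cite: RamosHulakDeQueiroz2026, Table A1 rows 15, 24] -/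
theorem no_legendrePair333_mul31 (a b : ZMod 333 → ℤ) (h : LegendrePair a b)
    (h31 : ∀ i, a (31 * i) = a i) : False := by
  have e : (112 : ZMod 333) = 31 * (31 * (31 * 31)) := by decide
  refine no_legendrePair333_mul112 a b h (fun i => ?_)
  rw [e]; simp only [mul_assoc]; rw [h31, h31, h31, h31]

/-- The same two statements for an `H`-invariant pair in the sense of arXiv:2607.20765 Definition 2, for any set
`H` of units containing `112` (rows 2, 7, 11) — and, by `exists_twisted_iff`, for translation-twisted `H` as well.
[cite: RamosHulakDeQueiroz2026, Table A1 rows 2, 7, 11] -/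
theorem no_hInvariant_legendrePair333_of_mem112 (H : Set (ZMod 333)ˣ) (u : (ZMod 333)ˣ) (hu : (u : ZMod 333) = 112)
    (huH : u ∈ H) :
    ¬ ∃ a b : ZMod 333 → ℤ, LegendrePair a b ∧ (∀ t ∈ H, TwistedInvariant a t) ∧ (∀ t ∈ H, TwistedInvariant b t) := by
  rw [exists_twisted_iff]
  rintro ⟨a, b, hab, ha, _hb⟩
  have h112 : ∀ i, a (112 * i) = a i := fun i => by rw [← hu]; exact ha u huH i
  exact no_legendrePair333_mul112 a b hab h112

end Length333

section Length117

/-- Length `117 = 3 · 39`, multiplier `40 = 39 + 1`: no Legendre pair of length 117 has its first sequence invariant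
under `40`. [cite: RamosHulakDeQueiroz2026, Thm 1 (method); question: Kotsireas–Koutschan 2021 §4.1.2] -/
theorem no_legendrePair117_mul40 (a b : ZMod 117 → ℤ) (h : LegendrePair a b)
    (h40 : ∀ i, a (40 * i) = a i) : False :=
  no_legendrePair_mul_succ (n := 117) (m := 39) (by norm_num) (by norm_num) a b h.1 h.2.1 h.2.2
    (Or.inl (by intro i; have := h40 i; push_cast; norm_num; exact this))

/-- **`H₂ = {1, 40, 79}` admits no Legendre pair of length 117**, in the strong form: no Legendre pair of length
117 has a sequence of which `40` is a multiplier even in the translation-twisted sense `a (40 i) = a (i + c)`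
(the multiplier-group notion of Kotsireas–Koutschan); by symmetry of the Legendre condition the same holds for the
second sequence.  Settles the case left undecided in arXiv:2101.03116 §4.1.2.
[cite: KotsireasEtAl2023, Corollary 1 (reduction); question: Kotsireas–Koutschan 2021 §4.1.2] -/
theorem no_legendrePair117_twisted40 (a b : ZMod 117 → ℤ) (h : LegendrePair a b) (t : (ZMod 117)ˣ)
    (ht : (t : ZMod 117) = 40) (hmul : TwistedInvariant a t) : False := by
  obtain ⟨u, hu⟩ := exists_unit_rowsum a (pm_of_sq _ _ (rowsum_sq a b h))
  have hinv := hInvariant_translate_centroid a u hu t hmul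
  have hLP := legendrePair_translate a b h (moment a * ↑u⁻¹) 0
  refine no_legendrePair117_mul40 _ _ hLP (fun i => ?_)
  have := hinv i
  rw [ht] at this
  exact this

end Length117

end Literature.Combinatorics.Designs.LegendrePairs
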